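import Literature.Barriers.MatrixMultiplication.UniversalMethodBarrierDegenerationSliceRank
import Literature.Barriers.MatrixMultiplication.UniversalMethodBarrierProducts
import HarnessLib

/-!
# Matrix multiplication tensors have large slice rank (Alman 2021, Prop. 2.5 and Cor. 2.6, after Strassen)

Topic `Literature/Barriers/MatrixMultiplication`; part of the PROOF of `UniversalMethodBarrier`
(Alman 2021): property (2) of §1.2, "matrix multiplication tensors have high (asymptotic) slice
rank", in the finite form consumed by the proof of Thm. 2.9:
`F·ABC ≤ (A+B+C-2) · S(F ⊙ ⟨A,B,C⟩)` (`mul_le_mul_sliceRank_multiple_matMul`, written with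
`(A-1)+(B-1)+(C-1)+1` to avoid truncated subtraction) and its cubic consequence
`F·M² ≤ 3 · S(F ⊙ ⟨M,M,M⟩)` (`mul_sq_le_three_mul_sliceRank_multiple_matMul`). PROVED over any
field. (The exact value `S(⟨n,n,n⟩) = n²` of BCCGU 2017 is the named fact `BCCGU2017_propB6` of
`NilpotentGroupBarrier.lean`; the present bounds are weaker by a constant but cover multiples and
rectangular formats, which is what the asymptotic argument needs.)

## Content

* `matMulDiagSet A B C s = Ψ_s` — the support triples `x_{il} y_{ij} z_{jl}` of `⟨A,B,C⟩`
  (`i < A`, `j < B`, `l < C`) with `i + j + l = s` (an antichain: each variable lies in at most one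
  triple), and `matMulDiagTensor K A B C s = E_s`, the `0/1` tensor on the format of `⟨A,B,C⟩`
  supported on `Ψ_s`.
* `polySubst_monomial`, `sq_add_two_mul_sub_le`, `coeff_matMulDiag_aux`,
  `polyDegeneratesTo_matMulDiagTensor` — **Strassen's monomial degeneration `⟨A,B,C⟩ ⊵ E_s`**
  (`s ≤ D := (A-1)+(B-1)+(C-1)`): the weights `u₁(x_{il}) = l² + 2il + 2s(C-1-l)`,
  `u₂(y_{ij}) = i² + 2ij + 2s(A-1-i)`, `u₃(z_{jl}) = j² + 2jl + 2s(B-1-j)` give the term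
  `x_{il}y_{ij}z_{jl}` the exponent `σ² + 2s(D-σ) = (σ-s)² + h`, `σ = i+j+l`, minimal exactly on
  `Ψ_s` (Alman Prop. 2.5 = Strassen 1987, Thm. 6.6, the degeneration; the size bound below is the
  elementary pigeonhole one, `ABC/(A+B+C-2)`, weaker than Strassen's printed
  `⌈¾·abc/max{a,b,c}⌉` by a constant factor).
* `exists_card_matMulDiagSet_ge` — **pigeonhole**: `i + j + l` takes at most `D + 1` values, so some
  `s ≤ D` has `(D+1)·|Ψ_s| ≥ ABC`.
* `tensorRestrictsTo_matMulDiagTensor_unitTensor` — `E_s ≥ ⟨|Ψ_s|⟩` (the three coordinate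
  projections are injective on `Ψ_s`); `mul_le_mul_sliceRank_multiple_matMul`,
  `mul_sq_le_three_mul_sliceRank_multiple_matMul` — with Tao's lemma (`sliceRank_unitTensor`) and
  Prop. 2.3 (`PolyDegeneratesTo.sliceRank_le`); these imply Alman's Cor. 2.6
  `S̃(⟨a,b,c⟩) ≥ abc/max{a,b,c}` asymptotically (on `⟨a,b,c⟩^{⊗n} ≃ ⟨aⁿ,bⁿ,cⁿ⟩` the factor
  `aⁿ+bⁿ+cⁿ-2` is `≤ 3·max{a,b,c}ⁿ` and `3^{1/n} → 1`), which is the form in which Cor. 2.6 is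
  cited on them.

## References

* J. Alman, Theory of Computing 17 (2021), Prop. 2.4–2.5, Cor. 2.6 (p. 13) = arXiv:1812.08731,
  Prop. 3.5 / Cor. 3.6. [Alman2021]
* V. Strassen, J. reine angew. Math. 375/376 (1987), Thm. 6.6 — cited through [Alman2021]
  (with Alman–Vassilevska Williams 2018, Lemma 4.2); the same construction in the cubic case is
  P. Bürgisser, M. Clausen, M. A. Shokrollahi, *Algebraic Complexity Theory* (1997), Lemma (15.31),
  p. 429.
-/

noncomputable section

open scoped BigOperators Polynomial

namespace Literature.Barriers.MatrixMultiplication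

open Literature.Computability.AlgebraicComplexity

universe u

section Diag

variable (K : Type u) [Field K]

/-- `Ψ_s`: the support triples `(i, j, l)` of `⟨A,B,C⟩ = Σ x_{il} y_{ij} z_{jl}` (`i < A`, `j < B`,
`l < C`) with `i + j + l = s` — an antichain (each variable occurs in at most one triple):
Strassen's combinatorial degeneration of `⟨A,B,C⟩` (Alman 2021, Prop. 2.5, citing Strassen 1987,
Thm. 6.6). [cite: Alman2021, Prop. 2.5] -/
def matMulDiagSet (A B C s : ℕ) : Finset (Fin A × Fin B × Fin C) :=
  Finset.univ.filter fun p => (p.1 : ℕ) + p.2.1 + p.2.2 = s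

/-- `E_s`: the tensor on the format of `⟨A,B,C⟩` supported (with coefficient `1`) exactly on the
triples `x_{il} y_{ij} z_{jl}` with `i + j + l = s` (a copy of the independent tensor `⟨|Ψ_s|⟩`).
[cite: Alman2021, Prop. 2.5] -/
def matMulDiagTensor (A B C s : ℕ) : Fin A × Fin C → Fin A × Fin B → Fin B × Fin C → K :=
  fun a b c => if a.1 = b.1 ∧ b.2 = c.1 ∧ a.2 = c.2 ∧ (a.1 : ℕ) + b.2 + a.2 = s then 1 else 0

variable {K}

/-- Substitution with diagonal monomial maps `x ↦ λ^{f(x)} x`. [folklore] -/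
theorem polySubst_monomial {ι κ μ : Type*} [Fintype ι] [Fintype κ] [Fintype μ] [DecidableEq ι]
    [DecidableEq κ] [DecidableEq μ] (t : ι → κ → μ → K) (f : ι → ℕ) (g : κ → ℕ) (k : μ → ℕ)
    (a' : ι) (b' : κ) (c' : μ) :
    polySubst t (fun a a' => if a' = a then Polynomial.X ^ f a else 0)
        (fun b b' => if b' = b then Polynomial.X ^ g b else 0)
        (fun c c' => if c' = c then Polynomial.X ^ k c else 0) a' b' c' =
      Polynomial.C (t a' b' c') * Polynomial.X ^ (f a' + g b' + k c') := by
  simp only [polySubst]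
  rw [Finset.sum_eq_single a']
  · rw [Finset.sum_eq_single b']
    · rw [Finset.sum_eq_single c']
      · simp [pow_add]
      · intro c _ hc; simp [Ne.symm hc]
      · simp
    · intro b _ hb; exact Finset.sum_eq_zero fun c _ => by simp [Ne.symm hb]
    · simp
  · intro a _ ha
    exact Finset.sum_eq_zero fun b _ => Finset.sum_eq_zero fun c _ => by simp [Ne.symm ha]
  · simp

/-- The quadratic exponent bookkeeping: `σ² + 2s(D - σ) ≥ s² + 2s(D - s)` with equality iff
`σ = s` (`σ, s ≤ D`). [folklore] -/
theorem sq_add_two_mul_sub_le {σ s D : ℕ} (hσ : σ ≤ D) (hs : s ≤ D) :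
    s * s + 2 * s * (D - s) ≤ σ * σ + 2 * s * (D - σ) ∧
      (s * s + 2 * s * (D - s) = σ * σ + 2 * s * (D - σ) ↔ σ = s) := by
  refine ⟨?_, ⟨fun h => ?_, fun h => by rw [h]⟩⟩
  · zify [hσ, hs]
    nlinarith [sq_nonneg ((σ : ℤ) - s)]
  · zify [hσ, hs] at h
    have h2 : ((σ : ℤ) - s) ^ 2 = 0 := by nlinarith [sq_nonneg ((σ : ℤ) - s)]
    have := pow_eq_zero_iff (n := 2) (by norm_num) |>.1 h2
    omega

/-- The coefficient computation behind Strassen's degeneration (next theorem): on a support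
triple the exponent is `σ² + 2s(D - σ)`, `σ = i + j + l`, `D = (A-1)+(B-1)+(C-1)`.
[cite: Alman2021, Prop. 2.5] -/
theorem coeff_matMulDiag_aux (A B C s : ℕ) (hs : s ≤ (A - 1) + (B - 1) + (C - 1))
    (a' : Fin A × Fin C) (b' : Fin A × Fin B) (c' : Fin B × Fin C) (j : ℕ)
    (hj : j ≤ s * s + 2 * s * ((A - 1) + (B - 1) + (C - 1) - s)) :
    (Polynomial.C (matMulTensor K A B C a' b' c') * Polynomial.X ^
      ((a'.2 : ℕ) * a'.2 + 2 * a'.1 * a'.2 + 2 * s * (C - 1 - a'.2) +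
       ((b'.1 : ℕ) * b'.1 + 2 * b'.1 * b'.2 + 2 * s * (A - 1 - b'.1)) +
       ((c'.1 : ℕ) * c'.1 + 2 * c'.1 * c'.2 + 2 * s * (B - 1 - c'.1)))).coeff j =
    if j = s * s + 2 * s * ((A - 1) + (B - 1) + (C - 1) - s) then matMulDiagTensor K A B C s a' b' c'
      else 0 := by
  obtain ⟨i, l⟩ := a'
  obtain ⟨i', j'⟩ := b'
  obtain ⟨j'', l'⟩ := c'
  simp only [matMulTensor, matMulDiagTensor]
  by_cases hsupp : i = i' ∧ j' = j'' ∧ l = l'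
  · obtain ⟨rfl, rfl, rfl⟩ := hsupp
    simp only [and_self, true_and, if_true, map_one, one_mul, Polynomial.coeff_X_pow]
    -- the exponent is `σ² + 2s(D - σ)` with `σ = i + j + l`
    have hi := i.isLt; have hj' := j'.isLt; have hl := l.isLt
    have hσ : (i : ℕ) + j' + l ≤ (A - 1) + (B - 1) + (C - 1) := by omega
    have hexp : (l : ℕ) * l + 2 * i * l + 2 * s * (C - 1 - l) +
        ((i : ℕ) * i + 2 * i * j' + 2 * s * (A - 1 - i)) +
        ((j' : ℕ) * j' + 2 * j' * l + 2 * s * (B - 1 - j')) =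
        ((i : ℕ) + j' + l) * ((i : ℕ) + j' + l) +
          2 * s * ((A - 1) + (B - 1) + (C - 1) - ((i : ℕ) + j' + l)) := by
      have e1 : 2 * s * (C - 1 - l) + 2 * s * (A - 1 - i) + 2 * s * (B - 1 - j') =
          2 * s * ((A - 1) + (B - 1) + (C - 1) - ((i : ℕ) + j' + l)) := by
        rw [← Nat.mul_add, ← Nat.mul_add]
        congr 1
        omega
      nlinarith [e1]
    rw [hexp]
    obtain ⟨hle, hiff⟩ := sq_add_two_mul_sub_le hσ hs
    by_cases hjh : j = s * s + 2 * s * ((A - 1) + (B - 1) + (C - 1) - s)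
    · subst hjh
      rw [if_pos rfl]
      by_cases hσs : (i : ℕ) + j' + l = s
      · rw [if_pos (hiff.2 hσs), if_pos hσs]
      · rw [if_neg (fun e => hσs (hiff.1 e)), if_neg hσs]
    · rw [if_neg hjh, if_neg]
      omega
  · have h2 : ¬ (i = i' ∧ j' = j'' ∧ l = l' ∧ (i : ℕ) + j' + l = s) :=
      fun h => hsupp ⟨h.1, h.2.1, h.2.2.1⟩
    simp only [if_neg hsupp, if_neg h2, map_zero, zero_mul, Polynomial.coeff_zero, ite_self]

/-- **Strassen's degeneration of `⟨A,B,C⟩` to the independent tensor on `Ψ_s`** (Alman 2021,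
Prop. 2.5; Strassen 1987, Thm. 6.6; same construction as Bürgisser–Clausen–Shokrollahi,
Lemma (15.31)): with the weights
`u₁(x_{il}) = l² + 2il + 2s(C-1-l)`, `u₂(y_{ij}) = i² + 2ij + 2s(A-1-i)`,
`u₃(z_{jl}) = j² + 2jl + 2s(B-1-j)`, the term `x_{il}y_{ij}z_{jl}` gets the exponent
`(i+j+l-s)² + h`, minimal exactly on `Ψ_s` (`s ≤ D = (A-1)+(B-1)+(C-1)`).
[cite: Alman2021, Prop. 2.5] -/
theorem polyDegeneratesTo_matMulDiagTensor (A B C s : ℕ) (hs : s ≤ (A - 1) + (B - 1) + (C - 1)) :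
    PolyDegeneratesTo (matMulTensor K A B C) (matMulDiagTensor K A B C s) := by
  have key : IsPolyDegen (s * s + 2 * s * ((A - 1) + (B - 1) + (C - 1) - s)) (matMulTensor K A B C)
      (matMulDiagTensor K A B C s)
      (fun a a' => if a' = a then
        Polynomial.X ^ ((a.2 : ℕ) * a.2 + 2 * a.1 * a.2 + 2 * s * (C - 1 - a.2)) else 0)
      (fun b b' => if b' = b then
        Polynomial.X ^ ((b.1 : ℕ) * b.1 + 2 * b.1 * b.2 + 2 * s * (A - 1 - b.1)) else 0)
      (fun c c' => if c' = c then
        Polynomial.X ^ ((c.1 : ℕ) * c.1 + 2 * c.1 * c.2 + 2 * s * (B - 1 - c.1)) else 0) := by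
    intro a' b' c' j hj
    rw [polySubst_monomial]
    exact coeff_matMulDiag_aux A B C s hs a' b' c' j hj
  exact key.polyDegeneratesTo

/-- **Counting** (pigeonhole over the `D + 1` possible values of `i + j + l`): some `s ≤ D` has
`(D+1)·|Ψ_s| ≥ ABC`, `D = (A-1)+(B-1)+(C-1)`. [folklore] -/
theorem exists_card_matMulDiagSet_ge (A B C : ℕ) :
    ∃ s, s ≤ (A - 1) + (B - 1) + (C - 1) ∧
      A * B * C ≤ ((A - 1) + (B - 1) + (C - 1) + 1) * (matMulDiagSet A B C s).card := by
  classical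
  set D := (A - 1) + (B - 1) + (C - 1) with hD
  set f : Fin A × Fin B × Fin C → ℕ := fun p => (p.1 : ℕ) + p.2.1 + p.2.2 with hf
  have hmaps : ∀ p ∈ (Finset.univ : Finset (Fin A × Fin B × Fin C)), f p ∈ Finset.range (D + 1) := by
    rintro ⟨i, j, l⟩ -
    have := i.isLt; have := j.isLt; have := l.isLt
    simp only [hf, Finset.mem_range]
    omega
  obtain ⟨s₀, hs₀, hmax⟩ := Finset.exists_max_image (Finset.range (D + 1))
    (fun s => (matMulDiagSet A B C s).card) ⟨0, by simp⟩
  refine ⟨s₀, Nat.lt_succ_iff.1 (Finset.mem_range.1 hs₀), ?_⟩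
  have hfib : ∀ s, (Finset.univ.filter fun p : Fin A × Fin B × Fin C => f p = s) =
      matMulDiagSet A B C s := fun s => rfl
  calc A * B * C = (Finset.univ : Finset (Fin A × Fin B × Fin C)).card := by
        simp [Fintype.card_prod, Fintype.card_fin, mul_assoc]
    _ = ∑ s ∈ Finset.range (D + 1), (matMulDiagSet A B C s).card := by
        rw [Finset.card_eq_sum_card_fiberwise hmaps]
        exact Finset.sum_congr rfl fun s _ => by rw [hfib]
    _ ≤ ∑ _s ∈ Finset.range (D + 1), (matMulDiagSet A B C s₀).card :=
        Finset.sum_le_sum fun s hs => hmax s hs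
    _ = (D + 1) * (matMulDiagSet A B C s₀).card := by
        rw [Finset.sum_const, Finset.card_range, smul_eq_mul]

/-- `E_s` restricts to the unit tensor `⟨|Ψ_s|⟩` (relabel along the three coordinate projections
of `Ψ_s`, which are injective on `Ψ_s`). [cite: Alman2021, Prop. 2.5] -/
theorem tensorRestrictsTo_matMulDiagTensor_unitTensor (A B C s : ℕ) :
    TensorRestrictsTo (matMulDiagTensor K A B C s) (unitTensor K (matMulDiagSet A B C s).card) := by
  classical
  set e := (matMulDiagSet A B C s).equivFin.symm with he
  have hmem : ∀ t, ((e t : Fin A × Fin B × Fin C).1 : ℕ) + (e t : Fin A × Fin B × Fin C).2.1 +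
      (e t : Fin A × Fin B × Fin C).2.2 = s := fun t => (Finset.mem_filter.1 (e t).2).2
  have key : unitTensor K (matMulDiagSet A B C s).card = fun t₁ t₂ t₃ => matMulDiagTensor K A B C s
      ((e t₁ : Fin A × Fin B × Fin C).1, (e t₁ : Fin A × Fin B × Fin C).2.2)
      ((e t₂ : Fin A × Fin B × Fin C).1, (e t₂ : Fin A × Fin B × Fin C).2.1)
      ((e t₃ : Fin A × Fin B × Fin C).2.1, (e t₃ : Fin A × Fin B × Fin C).2.2) := by
    funext t₁ t₂ t₃
    simp only [unitTensor_apply, matMulDiagTensor]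
    refine if_congr ⟨?_, ?_⟩ rfl rfl
    · rintro ⟨rfl, rfl⟩
      exact ⟨rfl, rfl, rfl, hmem t₁⟩
    · rintro ⟨h1, h2, h3, h4⟩
      have m1 := hmem t₁; have m2 := hmem t₂; have m3 := hmem t₃
      have e12 : (e t₁ : Fin A × Fin B × Fin C) = e t₂ := by
        refine Prod.ext h1 (Prod.ext ?_ ?_)
        · apply Fin.ext; rw [h1] at h4; omega
        · apply Fin.ext; rw [h1] at h4 m1; omega
      have e13 : (e t₁ : Fin A × Fin B × Fin C) = e t₃ := by
        refine Prod.ext ?_ (Prod.ext ?_ h3)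
        · apply Fin.ext; rw [h3] at h4 m1; rw [h2] at h4; omega
        · apply Fin.ext; rw [h1] at h4 m1; rw [← h2]; omega
      exact ⟨e.injective (Subtype.ext e12), e.injective (Subtype.ext (e12.symm.trans e13))⟩
  rw [key]
  exact tensorRestrictsTo_precomp _ _ _ _

/-- **Multiples of matrix multiplication tensors have large slice rank**: for the `s` of
`exists_card_matMulDiagSet_ge`, `F ⊙ ⟨A,B,C⟩ ⊵ F ⊙ E_s ≥ ⟨F |Ψ_s|⟩`, so
`F·ABC ≤ (A+B+C-2) · S(F ⊙ ⟨A,B,C⟩)` — Alman 2021, Cor. 2.6 / Prop. 2.4–2.5 in the non-asymptotic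
form needed here (`S̃(⟨a,b,c⟩) = abc / max{a,b,c}` in print). [cite: Alman2021, Cor. 2.6] -/
theorem mul_le_mul_sliceRank_multiple_matMul (F A B C : ℕ) :
    F * (A * B * C) ≤ ((A - 1) + (B - 1) + (C - 1) + 1) *
      sliceRank (kroneckerTensor (unitTensor K F) (matMulTensor K A B C)) := by
  classical
  obtain ⟨s, hs, hcard⟩ := exists_card_matMulDiagSet_ge A B C
  have h1 : PolyDegeneratesTo (kroneckerTensor (unitTensor K F) (matMulTensor K A B C))
      (kroneckerTensor (unitTensor K F) (matMulDiagTensor K A B C s)) :=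
    (TensorRestrictsTo.refl (unitTensor K F)).polyDegeneratesTo.kronecker
      (polyDegeneratesTo_matMulDiagTensor A B C s hs)
  have h2 : TensorRestrictsTo (kroneckerTensor (unitTensor K F) (matMulDiagTensor K A B C s))
      (unitTensor K (F * (matMulDiagSet A B C s).card)) :=
    ((TensorRestrictsTo.refl (unitTensor K F)).kronecker
      (tensorRestrictsTo_matMulDiagTensor_unitTensor A B C s)).trans
      (tensorRestrictsTo_unitTensor_mul K _ _)
  have h3 := le_sliceRank_of_restrictsTo_unitTensor h2
  have h4 := h1.sliceRank_le
  calc F * (A * B * C) ≤ F * (((A - 1) + (B - 1) + (C - 1) + 1) * (matMulDiagSet A B C s).card) :=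
        Nat.mul_le_mul_left F hcard
    _ = ((A - 1) + (B - 1) + (C - 1) + 1) * (F * (matMulDiagSet A B C s).card) := by ring
    _ ≤ _ := Nat.mul_le_mul_left _ (h3.trans h4)

/-- The cubic case: `F · M² ≤ 3 · S(F ⊙ ⟨M,M,M⟩)`. [cite: Alman2021, Cor. 2.6] -/
theorem mul_sq_le_three_mul_sliceRank_multiple_matMul (F M : ℕ) :
    F * (M * M) ≤ 3 * sliceRank (kroneckerTensor (unitTensor K F) (matMulTensor K M M M)) := by
  have h := mul_le_mul_sliceRank_multiple_matMul (K := K) F M M M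
  rcases Nat.eq_zero_or_pos M with hM | hM
  · subst hM; simp
  · have h3 : (M - 1) + (M - 1) + (M - 1) + 1 ≤ 3 * M := by omega
    have h' : F * (M * M) * M ≤ 3 * sliceRank (kroneckerTensor (unitTensor K F) (matMulTensor K M M M)) * M :=
      calc F * (M * M) * M = F * (M * M * M) := by ring
        _ ≤ ((M - 1) + (M - 1) + (M - 1) + 1) *
            sliceRank (kroneckerTensor (unitTensor K F) (matMulTensor K M M M)) := h
        _ ≤ 3 * M * sliceRank (kroneckerTensor (unitTensor K F) (matMulTensor K M M M)) :=
            Nat.mul_le_mul_right _ h3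
        _ = 3 * sliceRank (kroneckerTensor (unitTensor K F) (matMulTensor K M M M)) * M := by ring
    exact Nat.le_of_mul_le_mul_right h' hM

end Diag



end Literature.Barriers.MatrixMultiplication

end
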